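import Literature.NumberTheory.ModularForms.EisensteinLatticeCosetQExpansion
import Mathlib.NumberTheory.ZetaValues
import Mathlib.NumberTheory.LegendreSymbol.AddCharacter
import HarnessLib

/-!
# Cyclotomic rationality of the `q_N`-expansion of `G_k^a`

Topic `Literature/NumberTheory/ModularForms`; namespace `Literature.NumberTheory.ModularForms`.
Sequel of `EisensteinLatticeCosetQExpansion` (the coefficients `latticeEisensteinCoeff N k a n` of
`G_k^a ∈ M_k(Γ(N))` in `q_N = e^{2πiτ/N}`).

* `cosetZeta_eq_sum_bernoulliFun` — the constant term is a Bernoulli–Hurwitz value: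
  `Z_k(d) = ∑_{j ∈ ℤ} (jN + d̃)^{-k} = -((2πi)^k / (k! N)) ∑_{b mod N} e^{-2πi b d̃/N} B_k(b/N)`
  (Diamond–Shurman §4.2 (4.6) with Ex. 4.4.4/§4.7: `ζ^d(k)` via Bernoulli polynomials; here from
  Mathlib's Fourier expansion `hasSum_one_div_pow_mul_fourier_mul_bernoulliFun` of `B_k` and
  orthogonality of the additive characters of `ℤ/Nℤ`);
* `normCoeff_mem` — **cyclotomic rationality**: for the normalising constant
  `c_k = (k-1)! N^k / (-2πi)^k`, every coefficient `c_k · bₙ(G_k^a)` lies in any subfield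
  `K ⊆ ℂ` containing `ζ_N = e^{2πi/N}` (Diamond–Shurman Thm. 4.2.3: `G_k^v ∈ M_k(Γ(N))` has
  Fourier coefficients in `(2πi)^k ℚ(μ_N)`);
* `cosetZeta_ne_zero_of_even` — `Z_k(d) ≠ 0` for even `k` (a series of non-negative reals with a
  positive term);

The sequel `EisensteinLatticeCosetFaithful` deduces that `SL₂(ℤ)/±Γ(N)` acts faithfully on the
`G_4^u` and that `G_3^{(1,0)} ≢ 0`; together these are the inputs of the rationality of the
`q_N`-expansions of the `SL₂(ℤ)`-translates of forms on `Γ₁(N)` (discharge of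
`Sturm1987_congruence_modPrime_gamma1`).  The one definition is the normalising constant
`latticeEisensteinNorm N k = (k-1)! N^k/(-2πi)^k` (no named fact).

## References

* [DiamondShurman2005] F. Diamond, J. Shurman, *A First Course in Modular Forms*, GTM 228
  (2005), §4.2 (4.5)–(4.6), Thm. 4.2.3; §4.7 (Bernoulli numbers and Hurwitz zeta).
-/

noncomputable section

namespace Literature.NumberTheory.ModularForms

open scoped MatrixGroups Real CongruenceSubgroup Matrix
open UpperHalfPlane hiding I
open EisensteinSeries Complex Filter Function PowerSeries
open Literature.NumberTheory.EllipticCurves.ModularForms (tsum_int_eq_sum_zmod_tsum intCast_mul_add_val)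

/-! ### The constant term as a Bernoulli–Hurwitz value -/

section Bernoulli

variable (N : ℕ) [NeZero N] (k : ℕ)

/-- Orthogonality of the additive characters of `ℤ/Nℤ`, as an indicator of a residue class:
`[n ≡ d (N)] = (1/N) ∑_{x mod N} e^{2πi x̃ (n - d̃)/N}`. [folklore] -/
theorem indicator_intCast_eq_sum_cexp (d : ZMod N) (n : ℤ) :
    (if ((n : ZMod N)) = d then (1 : ℂ) else 0) =
      (N : ℂ)⁻¹ * ∑ x : ZMod N, cexp (2 * π * Complex.I * (x.val * ((n : ℂ) - d.val)) / N) := by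
  have hN : (N : ℂ) ≠ 0 := by exact_mod_cast NeZero.ne N
  have hprim := ZMod.isPrimitive_stdAddChar N
  have hsum := AddChar.sum_mulShift ((n : ZMod N) - d) hprim
  rw [ZMod.card] at hsum
  have hterm : ∀ x : ZMod N, ZMod.stdAddChar (x * (((n : ZMod N)) - d)) =
      cexp (2 * π * Complex.I * (x.val * ((n : ℂ) - d.val)) / N) := by
    intro x
    have hx : x * (((n : ZMod N)) - d) = (((x.val : ℤ) * (n - (d.val : ℤ)) : ℤ) : ZMod N) := by
      push_cast
      rw [ZMod.natCast_zmod_val, ZMod.natCast_zmod_val]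
    rw [hx, ZMod.stdAddChar_coe]
    congr 1
    push_cast
    ring
  simp only [hterm] at hsum
  rw [hsum]
  by_cases h : (n : ZMod N) = d
  · rw [if_pos h, if_pos (sub_eq_zero.mpr h), inv_mul_cancel₀ hN]
  · rw [if_neg h, if_neg (fun h' ↦ h (sub_eq_zero.mp h')), Nat.cast_zero, mul_zero]

/-- The Fourier series `∑_{n ∈ ℤ} e^{2πi n x} n^{-k} = -((2πi)^k/k!) B_k(x)` for `x = b/N`,
`0 ≤ b ≤ N`, `k ≥ 2` (Mathlib `hasSum_one_div_pow_mul_fourier_mul_bernoulliFun`, with the term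
`n = 0` equal to `0`). [folklore] -/
theorem hasSum_cexp_mul_zpow_neg (hk : 2 ≤ k) {b : ℕ} (hb : b ≤ N) :
    HasSum (fun n : ℤ ↦ cexp (2 * π * Complex.I * (b * (n : ℂ)) / N) * (n : ℂ) ^ (-(k : ℤ)))
      (-(2 * π * Complex.I) ^ k / k.factorial * (bernoulliFun k ((b : ℝ) / N) : ℂ)) := by
  have hx : ((b : ℝ) / N) ∈ Set.Icc (0 : ℝ) 1 := by
    refine ⟨by positivity, ?_⟩
    rw [div_le_one (by exact_mod_cast NeZero.pos N)]
    exact_mod_cast hb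
  have h := hasSum_one_div_pow_mul_fourier_mul_bernoulliFun hk hx
  convert h using 2 with n
  rw [fourier_coe_apply, zpow_neg, zpow_natCast, one_div, mul_comm]
  congr 1
  congr 1
  push_cast
  ring

/-- **The constant term of `G_k^{(0,d)}` as a Bernoulli–Hurwitz value**:
`Z_k(d) = ∑_{j ∈ ℤ} (jN + d̃)^{-k} = -((2πi)^k/(k!·N)) ∑_{x mod N} e^{-2πi x̃ d̃/N} B_k(x̃/N)`
(`k ≥ 2`). [cite: DiamondShurman2005, §4.2 (4.6) and §4.7] -/
theorem cosetZeta_eq_sum_bernoulliFun (hk : 2 ≤ k) (d : ZMod N) :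
    cosetZeta N k d = -(2 * π * Complex.I) ^ k / k.factorial * (N : ℂ)⁻¹ *
      ∑ x : ZMod N, cexp (-(2 * π * Complex.I * (x.val * d.val) / N)) *
        (bernoulliFun k ((x.val : ℝ) / N) : ℂ) := by
  -- `Z_k(d)` as the sum over `ℤ` of the indicator of the class of `d`
  have hsum0 : Summable fun n : ℤ ↦ (n : ℂ) ^ (-(k : ℤ)) := by
    have := (hasSum_cexp_mul_zpow_neg N k hk (Nat.zero_le N)).summable
    simpa using this
  have hF : Summable fun n : ℤ ↦ (if ((n : ZMod N)) = d then (1 : ℂ) else 0) * (n : ℂ) ^ (-(k : ℤ)) :=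
    Summable.of_norm_bounded hsum0.norm fun n ↦ by
      rw [norm_mul]
      refine mul_le_of_le_one_left (norm_nonneg _) ?_
      split_ifs <;> simp
  have hZ : cosetZeta N k d =
      ∑' n : ℤ, (if ((n : ZMod N)) = d then (1 : ℂ) else 0) * (n : ℂ) ^ (-(k : ℤ)) := by
    rw [tsum_int_eq_sum_zmod_tsum N hF]
    simp only [intCast_mul_add_val, ite_mul, one_mul, zero_mul]
    rw [Finset.sum_eq_single d (fun x _ hx ↦ by simp [hx]) (fun h ↦ absurd (Finset.mem_univ _) h)]
    simp only [if_true, cosetZeta]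
    refine tsum_congr fun j ↦ ?_
    push_cast
    ring_nf
  rw [hZ]
  simp_rw [indicator_intCast_eq_sum_cexp N d, Finset.mul_sum, Finset.sum_mul]
  -- interchange the finite sum and the series
  have hs : ∀ x : ZMod N, Summable fun n : ℤ ↦
      (N : ℂ)⁻¹ * cexp (2 * π * Complex.I * (x.val * ((n : ℂ) - d.val)) / N) * (n : ℂ) ^ (-(k : ℤ)) := by
    intro x
    refine Summable.of_norm_bounded ((hsum0.norm).mul_left ‖(N : ℂ)⁻¹‖) fun n ↦ ?_
    rw [norm_mul, norm_mul, mul_assoc]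
    refine mul_le_mul_of_nonneg_left (mul_le_of_le_one_left (norm_nonneg _) ?_) (norm_nonneg _)
    rw [show (2 * π * Complex.I * (x.val * ((n : ℂ) - d.val)) / N : ℂ) =
      ↑(2 * π * (x.val * ((n : ℝ) - d.val)) / N : ℝ) * Complex.I by push_cast; ring,
      Complex.norm_exp_ofReal_mul_I]
  rw [Summable.tsum_finsetSum fun x _ ↦ hs x]
  refine Finset.sum_congr rfl fun x _ ↦ ?_
  have hx : x.val ≤ N := x.val_le
  have hmain := (hasSum_cexp_mul_zpow_neg N k hk hx).tsum_eq
  have hfun : (fun n : ℤ ↦ (N : ℂ)⁻¹ * cexp (2 * π * Complex.I * (x.val * ((n : ℂ) - d.val)) / N) *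
      (n : ℂ) ^ (-(k : ℤ))) = fun n : ℤ ↦ ((N : ℂ)⁻¹ * cexp (-(2 * π * Complex.I * (x.val * d.val) / N))) *
        (cexp (2 * π * Complex.I * (x.val * (n : ℂ)) / N) * (n : ℂ) ^ (-(k : ℤ))) := by
    funext n
    have he : cexp (2 * π * Complex.I * (x.val * ((n : ℂ) - d.val)) / N) =
        cexp (-(2 * π * Complex.I * (x.val * d.val) / N)) * cexp (2 * π * Complex.I * (x.val * (n : ℂ)) / N) := by
      rw [← Complex.exp_add]
      congr 1
      ring
    rw [he]
    ring
  rw [hfun, tsum_mul_left, hmain]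
  ring

end Bernoulli

/-! ### Cyclotomic rationality of the normalised coefficients -/

section Rational

variable (N : ℕ) [NeZero N] (k : ℕ)

/-- The normalising constant `c_k = (k-1)! N^k / (-2πi)^k` of `G_k^a` (so that `c_k G_k^a` has
Fourier coefficients in `ℚ(μ_N)`, Diamond–Shurman Thm. 4.2.3). [cite: DiamondShurman2005, Thm. 4.2.3] -/
def latticeEisensteinNorm : ℂ := (k - 1).factorial * (N : ℂ) ^ k / (-2 * π * Complex.I) ^ k

/-- `-2πi ≠ 0`. [folklore] -/
theorem neg_two_pi_I_ne_zero : (-2 * π * Complex.I : ℂ) ≠ 0 := by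
  simp [Real.pi_ne_zero, Complex.I_ne_zero]

/-- `c_k ≠ 0`. [folklore] -/
theorem latticeEisensteinNorm_ne_zero : latticeEisensteinNorm N k ≠ 0 := by
  unfold latticeEisensteinNorm
  have h1 : ((k - 1).factorial : ℂ) ≠ 0 := by exact_mod_cast Nat.factorial_ne_zero _
  have h2 : (N : ℂ) ^ k ≠ 0 := pow_ne_zero _ (by exact_mod_cast NeZero.ne N)
  exact div_ne_zero (mul_ne_zero h1 h2) (pow_ne_zero _ neg_two_pi_I_ne_zero)

/-- `c_k · (N^{-k} (-2πi)^k/(k-1)!) = 1`. [folklore] -/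
theorem latticeEisensteinNorm_mul_const :
    latticeEisensteinNorm N k * (((N : ℂ) ^ k)⁻¹ * ((-2 * π * Complex.I) ^ k / (k - 1).factorial)) = 1 := by
  unfold latticeEisensteinNorm
  have h1 : ((k - 1).factorial : ℂ) ≠ 0 := by exact_mod_cast Nat.factorial_ne_zero _
  have h2 : (N : ℂ) ^ k ≠ 0 := pow_ne_zero _ (by exact_mod_cast NeZero.ne N)
  have h3 := pow_ne_zero k neg_two_pi_I_ne_zero
  field_simp

/-- `c_k · (-(2πi)^k/(k! N)) = (-1)^{k+1} N^{k-1}/k`, a rational number (`k ≥ 1`). [folklore] -/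
theorem latticeEisensteinNorm_mul_bernoulliConst (hk : 1 ≤ k) :
    latticeEisensteinNorm N k * (-(2 * π * Complex.I) ^ k / k.factorial * (N : ℂ)⁻¹) =
      (((-1) ^ (k + 1) * (N : ℚ) ^ (k - 1) / k : ℚ) : ℂ) := by
  obtain ⟨j, rfl⟩ : ∃ j, k = j + 1 := ⟨k - 1, by omega⟩
  unfold latticeEisensteinNorm
  have hN : (N : ℂ) ≠ 0 := by exact_mod_cast NeZero.ne N
  have h1 : ((j + 1 : ℕ) : ℂ) ≠ 0 := by exact_mod_cast Nat.succ_ne_zero j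
  have hj : ((j.factorial : ℕ) : ℂ) ≠ 0 := by exact_mod_cast Nat.factorial_ne_zero j
  have hpi : (2 * π * Complex.I : ℂ) ≠ 0 := by simp [Real.pi_ne_zero, Complex.I_ne_zero]
  have hinv : ((-2 * π * Complex.I : ℂ) ^ (j + 1))⁻¹ = (-1) ^ (j + 1) * ((2 * π * Complex.I) ^ (j + 1))⁻¹ := by
    rw [show (-2 * (π : ℂ) * Complex.I) = (-1) * (2 * π * Complex.I) by ring, mul_pow, mul_inv,
      ← inv_pow, inv_neg_one]
  simp only [Nat.add_sub_cancel, Nat.factorial_succ, div_eq_mul_inv, hinv]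
  push_cast
  field_simp
  ring

variable {N} in
omit [NeZero N] in
/-- `e^{2πi m/N} = ζ_N^m` lies in every subfield containing `ζ_N = e^{2πi/N}`. [folklore] -/
theorem cexp_natMul_mem {K : Subfield ℂ} (hζ : cexp (2 * π * Complex.I / N) ∈ K) (m : ℕ) :
    cexp (2 * π * Complex.I * m / N) ∈ K := by
  rw [show (2 * π * Complex.I * m / N : ℂ) = (m : ℂ) * (2 * π * Complex.I / N) by ring,
    Complex.exp_nat_mul]
  exact pow_mem hζ m

variable {N} in
omit [NeZero N] in
/-- `e^{-2πi m/N} = ζ_N^{-m}` lies in every subfield containing `ζ_N`. [folklore] -/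
theorem cexp_neg_natMul_mem {K : Subfield ℂ} (hζ : cexp (2 * π * Complex.I / N) ∈ K) (m : ℕ) :
    cexp (-(2 * π * Complex.I * m / N)) ∈ K := by
  rw [Complex.exp_neg]
  exact inv_mem (cexp_natMul_mem hζ m)

variable {N k} in
omit [NeZero N] in
/-- The weights `w_a(c, m)` lie in every subfield containing `ζ_N`. [folklore] -/
theorem latticeEisensteinWeight_mem {K : Subfield ℂ} (hζ : cexp (2 * π * Complex.I / N) ∈ K)
    (a : Fin 2 → ZMod N) (c m : ℕ) : latticeEisensteinWeight N k a c m ∈ K := by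
  unfold latticeEisensteinWeight
  refine add_mem ?_ (mul_mem (pow_mem (neg_mem (one_mem K)) k) ?_)
  · split_ifs
    · have := cexp_natMul_mem hζ ((a 1).val * m)
      push_cast at this
      exact this
    · exact zero_mem K
  · split_ifs
    · have := cexp_neg_natMul_mem hζ ((a 1).val * m)
      push_cast at this
      exact this
    · exact zero_mem K

variable {N k} in
/-- `c_k Z_k(d)` lies in every subfield containing `ζ_N` (`k ≥ 2`): by
`cosetZeta_eq_sum_bernoulliFun` it is `(-1)^{k+1}(N^{k-1}/k) ∑_x ζ_N^{-x̃d̃} B_k(x̃/N)` with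
`B_k(x̃/N) ∈ ℚ`. [cite: DiamondShurman2005, Thm. 4.2.3] -/
theorem latticeEisensteinNorm_mul_cosetZeta_mem {K : Subfield ℂ}
    (hζ : cexp (2 * π * Complex.I / N) ∈ K) (hk : 2 ≤ k) (d : ZMod N) :
    latticeEisensteinNorm N k * cosetZeta N k d ∈ K := by
  rw [cosetZeta_eq_sum_bernoulliFun N k hk d, ← mul_assoc,
    latticeEisensteinNorm_mul_bernoulliConst N k (by omega)]
  refine mul_mem (SubfieldClass.ratCast_mem K _) (sum_mem fun x _ ↦ mul_mem ?_ ?_)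
  · have := cexp_neg_natMul_mem hζ (x.val * d.val)
    push_cast at this
    exact this
  · have hB : (bernoulliFun k ((x.val : ℝ) / N) : ℂ) =
        (((Polynomial.bernoulli k).eval ((x.val : ℚ) / N) : ℚ) : ℂ) := by
      have h1 : ((x.val : ℝ) / N) = algebraMap ℚ ℝ ((x.val : ℚ) / N) := by
        rw [eq_ratCast]; push_cast; rfl
      rw [bernoulliFun, Polynomial.eval_map, h1, Polynomial.eval₂_at_apply, eq_ratCast,
        Complex.ofReal_ratCast]
    rw [hB]
    exact SubfieldClass.ratCast_mem K _

variable {N k} in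
/-- **Cyclotomic rationality of the `q_N`-expansion of `G_k^a`** (Diamond–Shurman Thm. 4.2.3:
`G_k^v ∈ M_k(Γ(N))` has Fourier coefficients in `(2πi)^k ℚ(μ_N)`): every normalised coefficient
`c_k bₙ(G_k^a)`, `c_k = (k-1)! N^k/(-2πi)^k`, lies in any subfield `K ⊆ ℂ` containing `ζ_N`.
[cite: DiamondShurman2005, Thm. 4.2.3] -/
theorem latticeEisensteinNorm_mul_coeff_mem {K : Subfield ℂ} (hζ : cexp (2 * π * Complex.I / N) ∈ K)
    (hk : 2 ≤ k) (a : Fin 2 → ZMod N) (n : ℕ) :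
    latticeEisensteinNorm N k * latticeEisensteinCoeff N k a n ∈ K := by
  unfold latticeEisensteinCoeff
  split_ifs with hn ha
  · exact latticeEisensteinNorm_mul_cosetZeta_mem hζ hk (a 1)
  · rw [mul_zero]; exact zero_mem K
  · rw [← mul_assoc, latticeEisensteinNorm_mul_const, one_mul]
    exact sum_mem fun p _ ↦ mul_mem (latticeEisensteinWeight_mem hζ a p.1 p.2)
      (pow_mem (natCast_mem K p.2) _)

variable {N k} in
/-- The same for the modular form: `c_k · coeff n (qExpansion N G_k^a) ∈ K` (`k ≥ 3`).
[cite: DiamondShurman2005, Thm. 4.2.3] -/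
theorem latticeEisensteinNorm_mul_qExpansion_coeff_mem {K : Subfield ℂ}
    (hζ : cexp (2 * π * Complex.I / N) ∈ K) (hk : 3 ≤ k) (a : Fin 2 → ZMod N) (n : ℕ) :
    latticeEisensteinNorm N k *
      (qExpansion (N : ℝ) (latticeEisensteinMF N (k := (k : ℤ)) (by exact_mod_cast hk) a)).coeff n ∈ K := by
  rw [qExpansion_coeff_latticeEisensteinMF N k a hk n]
  exact latticeEisensteinNorm_mul_coeff_mem hζ (by omega) a n

end Rational

/-! ### Non-vanishing of the constant term in even weight -/

section Nonvanishing

variable (N : ℕ) [NeZero N] (k : ℕ)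

/-- `Z_k(d)` as a sum over `ℤ` of the indicator of the class of `d`:
`Z_k(d) = ∑_{n ∈ ℤ} [n ≡ d] n^{-k}` (`k ≥ 2`). [folklore] -/
theorem cosetZeta_eq_tsum_indicator (hk : 2 ≤ k) (d : ZMod N) :
    (Summable fun n : ℤ ↦ (if ((n : ZMod N)) = d then (1 : ℂ) else 0) * (n : ℂ) ^ (-(k : ℤ))) ∧
    cosetZeta N k d =
      ∑' n : ℤ, (if ((n : ZMod N)) = d then (1 : ℂ) else 0) * (n : ℂ) ^ (-(k : ℤ)) := by
  have hsum0 : Summable fun n : ℤ ↦ (n : ℂ) ^ (-(k : ℤ)) := by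
    have := (hasSum_cexp_mul_zpow_neg N k hk (Nat.zero_le N)).summable
    simpa using this
  have hF : Summable fun n : ℤ ↦ (if ((n : ZMod N)) = d then (1 : ℂ) else 0) * (n : ℂ) ^ (-(k : ℤ)) :=
    Summable.of_norm_bounded hsum0.norm fun n ↦ by
      rw [norm_mul]
      refine mul_le_of_le_one_left (norm_nonneg _) ?_
      split_ifs <;> simp
  refine ⟨hF, ?_⟩
  rw [tsum_int_eq_sum_zmod_tsum N hF]
  simp only [intCast_mul_add_val, ite_mul, one_mul, zero_mul]
  rw [Finset.sum_eq_single d (fun x _ hx ↦ by simp [hx]) (fun h ↦ absurd (Finset.mem_univ _) h)]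
  simp only [if_true, cosetZeta]
  refine tsum_congr fun j ↦ ?_
  push_cast
  ring_nf

/-- For even `k`, `n^{-k}` (`n ∈ ℤ`) is the non-negative real `(n^k)⁻¹`. [folklore] -/
theorem intCast_zpow_neg_eq_ofReal (n : ℤ) :
    ((n : ℂ) ^ (-(k : ℤ))) = ((((n : ℝ) ^ k)⁻¹ : ℝ) : ℂ) := by
  rw [zpow_neg, zpow_natCast]
  push_cast
  rfl

/-- **`Z_k(d) ≠ 0` for even `k ≥ 2`**: it is a series of non-negative reals whose term
`n = N + d̃ ≡ d` is positive. [folklore] -/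
theorem cosetZeta_ne_zero_of_even (hk : 2 ≤ k) (heven : Even k) (d : ZMod N) :
    cosetZeta N k d ≠ 0 := by
  obtain ⟨hF, hZ⟩ := cosetZeta_eq_tsum_indicator N k hk d
  set F : ℤ → ℂ := fun n ↦ (if ((n : ZMod N)) = d then (1 : ℂ) else 0) * (n : ℂ) ^ (-(k : ℤ)) with hFdef
  have hre : ∀ n : ℤ, (F n).re = (if ((n : ZMod N)) = d then ((n : ℝ) ^ k)⁻¹ else 0) := by
    intro n
    show ((if ((n : ZMod N)) = d then (1 : ℂ) else 0) * (n : ℂ) ^ (-(k : ℤ))).re = _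
    rw [intCast_zpow_neg_eq_ofReal]
    split_ifs <;> simp only [one_mul, zero_mul, Complex.ofReal_re, Complex.zero_re]
  have hnonneg : ∀ n : ℤ, 0 ≤ (F n).re := fun n ↦ by
    rw [hre]
    split_ifs
    · exact inv_nonneg.mpr (heven.pow_nonneg _)
    · exact le_rfl
  -- the positive term
  set n₀ : ℤ := (N : ℤ) + (d.val : ℤ) with hn₀
  have hn₀d : ((n₀ : ZMod N)) = d := by
    rw [hn₀]; push_cast; simp
  have hn₀pos : (0 : ℝ) < (n₀ : ℝ) := by
    rw [hn₀]; push_cast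
    have : (0 : ℝ) < N := by exact_mod_cast NeZero.pos N
    positivity
  have hpos : 0 < (F n₀).re := by
    rw [hre, if_pos hn₀d]
    exact inv_pos.mpr (pow_pos hn₀pos k)
  have hsre : Summable fun n ↦ (F n).re := (Complex.hasSum_re hF.hasSum).summable
  have hle : (F n₀).re ≤ ∑' n, (F n).re := hsre.le_tsum n₀ fun n _ ↦ hnonneg n
  intro h0
  have : (cosetZeta N k d).re = ∑' n, (F n).re := by rw [hZ, Complex.re_tsum hF]
  rw [h0, Complex.zero_re] at this
  linarith

end Nonvanishing

end Literature.NumberTheory.ModularForms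

end
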